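import Literature.NumberTheory.EllipticCurves.LocalRestrictionDegree
import Literature.NumberTheory.EllipticCurves.LocalRestrictionFiniteDegree
import Literature.NumberTheory.EllipticCurves.SelmerImage
import Literature.NumberTheory.EllipticCurves.BSDRankZeroDensity
import Summits.BirchSwinnertonDyer.Rank1Residual.Additive.KummerSelmerRestriction
import HarnessLib

/-!
# Prime-to-`p` descent of the local `p`-Selmer condition along a tower of completions
# (class X11b, cell `b2b-bsdres`, unit `b2b-bsdres-sha-2`, gen 27; part (e4))

HONEST FRAMING (run/shared/lean/b2b/bsd-rank1-residual/, verbatim in every file): prove what is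
provable now; shrink each hard class to its core with data; no claim beyond stated classes. THEOREMS
ONLY — no new definition, no named fact, no `sorry`; nothing here moves a census label (the
census-lead's word decides labels).

## What

The GEN 27 one-directional consumers (`bsdp_of_congruent_*_localLe`, part (e2b)) ask, at each place
`v` of `T ∖ S`, for the inclusion `c ∈ 𝓢_v(W) ⟹ θ_* c ∈ 𝓢_v(Y)` on GLOBAL classes `c ∈ H¹(ℚ, W[p])`.
At the residual places of the 27 'PG/PG at `v = p`' rows (`gen27/typing/residual28/RESIDUAL-28.md`)
both curves acquire GOOD reduction over a finite extension `K′_w / ℚ_p` of degree prime to `p` and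
ramification `< p − 1`, where the Mazur–Rubin good-reduction comparison (the registered fact
`MazurRubin2015.selmerLocalKer_iff_of_goodReduction_above`) applies. To move the comparison back DOWN
to `ℚ_p` one needs the converse of the tree's `selmerLocalKer_le_of_tower` up to a prime-to-`p`
index. This file proves exactly that, FACT-FREE, from the tree's
`index_nsmul_mem_localRestrictionKer_of_tower` (Serre, *Galois Cohomology* I.§2.4: a class dying over
`E'` is killed over `E` by `[Γ_E : Γ_{Ẽ'}]`), `selmerLocalKer_eq_comap` (the `p`-Selmer local
condition is the preimage of the `Ш` local condition) and `zsmul_galH1Torsion_eq_zero` (`H¹(K, E[n])`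
is killed by `n`):

* `selmerLocalKer_le_of_tower_of_coprime_index` — for `K`-fields `E → E'` with `E'/E` finite and
  `[Γ_E : Γ_{Ẽ'}]` prime to `p`: `𝓢_{E'}(W)[p] ≤ 𝓢_E(W)[p]`, i.e. together with
  `selmerLocalKer_le_of_tower` the local `p`-Selmer conditions at `E` and at `E'` COINCIDE on
  `H¹(K, E[p])`;
* `selmerLocalKer_eq_of_tower_of_coprime_index` — the equality;
* `coprime_index_finGalSubgroup_of_pow_lt` — the index hypothesis from a DEGREE bound: if
  `[E' : E] ^ [E' : E] < p` then `[Γ_E : Γ_{Ẽ'}] ≤ [E' : E] ^ [E' : E] < p`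
  (`index_finGalSubgroup_le_pow`) is prime to `p` (covers `[E' : E] = 2`, `p ≥ 5`: the thirteen
  `I₀*/I₀*` rows of RESIDUAL-28; the degree-`3` rows need the sharper `[Γ_E : Γ_{Ẽ'}] ∣ [E' : E]!`,
  not in the tree — successor inventory);
* `localLe_of_tower_of_coprime_index` — the transport form used by the consumers: if the
  one-directional inclusion holds at the upper field `E'` for a pair of curves `W`, `Y` over `K` and an
  additive isomorphism `Φ : H¹(K, W[p]) → H¹(K, Y[p])` (in the records: `Φ = h1Equiv θ hθ`), then it
  holds at `E`.

References: J.-P. Serre, *Galois Cohomology*, I.§2.4 (Cor. to Prop. 9) [SerreGaloisCohomology1997];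
J. H. Silverman, *AEC*, X.§4 [Silverman2009]; B. Mazur, K. Rubin, Selmer companion curves, Trans. AMS
367 (2015), proof of Thm. 3.1 [MazurRubin2015SelmerCompanions].
-/

noncomputable section

open scoped Classical

universe u

open Field WeierstrassCurve
open Literature.NumberTheory.EllipticCurves
open Literature.NumberTheory.GaloisRepresentations

namespace Summit.BirchSwinnertonDyer.Rank1Residual.X11b.CongruentTransfer

variable {K : Type u} [Field K] (W : WeierstrassCurve K)
variable {E : Type u} [Field E] [Algebra K E]
variable {E' : Type u} [Field E'] [Algebra K E'] [Algebra E E'] [IsScalarTower K E E']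
variable [FiniteDimensional E E'] [CharZero E]

/-- **Prime-to-`p` descent of the local `p`-Selmer condition.** For `K`-fields `E → E'` with `E'/E`
finite and the index `[Γ_E : Γ_{Ẽ'}]` of the Galois closure prime to `p`, a class of `H¹(K, E[p])`
satisfying the local Selmer condition at `E'` satisfies it at `E`: its image `x ∈ H¹(K, E)` dies over
`E'`, hence `[Γ_E : Γ_{Ẽ'}] • x` dies over `E` (`index_nsmul_mem_localRestrictionKer_of_tower`), and so
does `p • x = 0` (`zsmul_galH1Torsion_eq_zero`); by Bézout `x` itself dies over `E`.
Serre, *Galois Cohomology*, I.§2.4. -/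
theorem selmerLocalKer_le_of_tower_of_coprime_index (p : ℕ)
    (hcop : Nat.Coprime (finGalSubgroup (E := E) E').index p) :
    selmerLocalKer W E' (p : ℤ) ≤ selmerLocalKer W E (p : ℤ) := by
  intro c hc
  rw [selmerLocalKer_eq_comap W E' (p : ℤ), AddSubgroup.mem_comap] at hc
  rw [selmerLocalKer_eq_comap W E (p : ℤ), AddSubgroup.mem_comap]
  set x : W.galH1 := torsionH1ToH1 W (p : ℤ) c with hx
  set m : ℕ := (finGalSubgroup (E := E) E').index with hm
  have h1 : (m : ℤ) • x ∈ W.localRestrictionKer E := by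
    rw [natCast_zsmul]
    exact index_nsmul_mem_localRestrictionKer_of_tower (E := E) W hc
  have h2 : (p : ℤ) • x = 0 := by
    rw [hx, ← map_zsmul, zsmul_galH1Torsion_eq_zero, map_zero]
  have hbez : ((m : ℤ) * Nat.gcdA m p + (p : ℤ) * Nat.gcdB m p) = 1 := by
    have h := Nat.gcd_eq_gcd_ab m p
    rw [Nat.Coprime.gcd_eq_one hcop, Nat.cast_one] at h
    exact h.symm
  have hxe : x = Nat.gcdA m p • ((m : ℤ) • x) + Nat.gcdB m p • ((p : ℤ) • x) :=
    calc x = (1 : ℤ) • x := (one_zsmul x).symm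
      _ = ((m : ℤ) * Nat.gcdA m p + (p : ℤ) * Nat.gcdB m p) • x := by rw [hbez]
      _ = Nat.gcdA m p • ((m : ℤ) • x) + Nat.gcdB m p • ((p : ℤ) • x) := by
          rw [add_zsmul, mul_zsmul', mul_zsmul']
  rw [hxe, h2, zsmul_zero, add_zero]
  exact AddSubgroup.zsmul_mem _ h1 _

/-- **The local `p`-Selmer conditions at `E` and at `E'` coincide** when `[Γ_E : Γ_{Ẽ'}]` is prime
to `p` (`selmerLocalKer_le_of_tower` and `selmerLocalKer_le_of_tower_of_coprime_index`). -/
theorem selmerLocalKer_eq_of_tower_of_coprime_index (p : ℕ)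
    (hcop : Nat.Coprime (finGalSubgroup (E := E) E').index p) :
    selmerLocalKer W E' (p : ℤ) = selmerLocalKer W E (p : ℤ) :=
  le_antisymm (selmerLocalKer_le_of_tower_of_coprime_index W p hcop)
    (selmerLocalKer_le_of_tower W (p : ℤ))

omit [IsScalarTower K E E'] [Algebra K E'] [Algebra K E] in
/-- **The index hypothesis from a degree bound**: `[E' : E] ^ [E' : E] < p` (with `p` prime) forces
`[Γ_E : Γ_{Ẽ'}]` (`≤ [E' : E] ^ [E' : E]`, `index_finGalSubgroup_le_pow`) to be prime to `p`. -/
theorem coprime_index_finGalSubgroup_of_pow_lt (p : ℕ) (hp : p.Prime)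
    (h : Module.finrank E E' ^ Module.finrank E E' < p) :
    Nat.Coprime (finGalSubgroup (E := E) E').index p := by
  have hle := index_finGalSubgroup_le_pow (E := E) E'
  have hne : (finGalSubgroup (E := E) E').index ≠ 0 := Subgroup.FiniteIndex.index_ne_zero
  exact Nat.coprime_comm.mp (Nat.coprime_of_lt_prime hne (hle.trans_lt h) hp)

/-- `[E' : E] ^ [E' : E] < p` version of `selmerLocalKer_le_of_tower_of_coprime_index`. -/
theorem selmerLocalKer_le_of_tower_of_pow_lt (p : ℕ) [hp : Fact p.Prime]
    (h : Module.finrank E E' ^ Module.finrank E E' < p) :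
    selmerLocalKer W E' (p : ℤ) ≤ selmerLocalKer W E (p : ℤ) :=
  selmerLocalKer_le_of_tower_of_coprime_index W p
    (coprime_index_finGalSubgroup_of_pow_lt (E := E) (E' := E') p hp.out h)

/-- **Transport form.** For two curves `W`, `Y` over `K`, an additive map
`Φ : H¹(K, W[p]) → H¹(K, Y[p])` (in the records `Φ = h1Equiv θ hθ` for a `Γ_K`-isomorphism
`θ : W[p] ⥲ Y[p]`) and `K`-fields `E → E'` with `[Γ_E : Γ_{Ẽ'}]` prime to `p`: the one-directional
local inclusion `c ∈ 𝓢_{E'}(W) ⟹ Φ c ∈ 𝓢_{E'}(Y)` at the UPPER field descends to the same inclusion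
at `E`. This is the shape of the `(d3)` disjunct of `bsdp_of_congruent_*_localLe` at `v = p` once the
upper-field inclusion is supplied (over a field where both curves have good reduction, by
`MazurRubin2015.selmerLocalKer_iff_of_goodReduction_above`). -/
theorem localLe_of_tower_of_coprime_index (Y : WeierstrassCurve K) (p : ℕ)
    (hcop : Nat.Coprime (finGalSubgroup (E := E) E').index p)
    (Φ : galH1Torsion W (p : ℤ) →+ galH1Torsion Y (p : ℤ))
    (hup : ∀ c : galH1Torsion W (p : ℤ),
      c ∈ selmerLocalKer W E' (p : ℤ) → Φ c ∈ selmerLocalKer Y E' (p : ℤ)) :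
    ∀ c : galH1Torsion W (p : ℤ),
      c ∈ selmerLocalKer W E (p : ℤ) → Φ c ∈ selmerLocalKer Y E (p : ℤ) := fun c hc ↦
  selmerLocalKer_le_of_tower_of_coprime_index Y p hcop
    (hup c (selmerLocalKer_le_of_tower W (p : ℤ) hc))

end Summit.BirchSwinnertonDyer.Rank1Residual.X11b.CongruentTransfer

/-! ## Audit hooks -/
#print axioms Summit.BirchSwinnertonDyer.Rank1Residual.X11b.CongruentTransfer.selmerLocalKer_le_of_tower_of_coprime_index
#print axioms Summit.BirchSwinnertonDyer.Rank1Residual.X11b.CongruentTransfer.selmerLocalKer_le_of_tower_of_pow_lt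
#print axioms Summit.BirchSwinnertonDyer.Rank1Residual.X11b.CongruentTransfer.localLe_of_tower_of_coprime_index
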